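import Summits.BirchSwinnertonDyer.BirchSwinnertonDyer.Theorems.ManinLocalTwoThreeEulerRemaindersTwenty
import HarnessLib

/-!
# The Euler functions at level 24: `x`, `y`, `φ₂₄` as `q`-monomials times Euler functions; the derivatives
# of `x`, `y`

Cell bsd-f2-manin, route `ManinLocalTwoThree`; the level-`24` twin of `ManinLocalTwoThreeEulerRemaindersTwenty`
(toolkit for the three limits (T1)₂₄–(T3)₂₄ of `NeronSqueezeTwentyFour.abs_maninConstant_eq_one_twentyFour_of_tendsto`).
With `E_δ(τ) = ∏_{n ≥ 1} (1 − q^{δn})` (`eulerFn δ`), `q = e^{2πiτ}`: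

* `x = η(6τ)³η(8τ)/(η(2τ)η(24τ)³) = E₆³E₈/(q²E₂E₂₄³)`, `y = η(4τ)η(8τ)²η(12τ)⁵/(η(2τ)η(6τ)η(24τ)⁶) =
  E₄E₈²E₁₂⁵/(q³E₂E₆E₂₄⁶)`, `φ₂₄ = η(2τ)η(4τ)η(6τ)η(12τ) = qE₂E₄E₆E₁₂` (`x24_eq`, `y24_eq`, `etaProductTwentyFour_eq`);
* the logarithmic derivatives `deriv_x24`, `deriv_y24`.

The truncations of `E₂, E₄, E₆` and their derivatives are in `EulerRemaindersTwenty`, `EulerRemaindersThirtyTwo`,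
`LigozatIdentitiesThirtySix`.
-/

set_option autoImplicit false
set_option linter.dupNamespace false

noncomputable section

open Complex Filter Topology Set Asymptotics Polynomial
open UpperHalfPlane hiding I
open scoped Real Topology Manifold MatrixGroups
open Literature.NumberTheory.EllipticCurves Literature.NumberTheory.EllipticCurves.ModularForms

namespace Summit.BirchSwinnertonDyer.BirchSwinnertonDyer.Theorems.ManinLocalTwoThree.EulerRemaindersTwentyFour

open QRemainder EulerRemainders
open LigozatIdentities (hasDerivAt_eulerFn_comp)

/-! ## 1. `x`, `y`, `φ₂₄` in terms of `q` and the Euler functions -/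

/-- **`x = η(6τ)³η(8τ)/(η(2τ)η(24τ)³) = E₆³E₈/(q² E₂ E₂₄³)`.** [folklore] -/
theorem x24_eq (τ : ℍ) :
    etaQuotient 24 (expFn [(2, -1), (6, 3), (8, 1), (24, -3)]) τ
      = eulerFn 6 τ ^ 3 * eulerFn 8 τ
        / (Function.Periodic.qParam 1 (τ : ℂ) ^ 2 * eulerFn 2 τ * eulerFn 24 τ ^ 3) := by
  have hE2 := eulerFn_ne_zero (by norm_num : 0 < 2) τ
  have hE24 := eulerFn_ne_zero (by norm_num : 0 < 24) τ
  have hq := qParam_ne_zero τ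
  rw [etaQuotient_eq_cexp_mul_prod, show Nat.divisors 24 = {1, 2, 3, 4, 6, 8, 12, 24} by decide]
  have hsum : (∑ δ ∈ ({1, 2, 3, 4, 6, 8, 12, 24} : Finset ℕ),
      (δ : ℤ) * expFn [(2, -1), (6, 3), (8, 1), (24, -3)] δ) = (-(24 * 2 : ℕ) : ℤ) := by decide
  rw [hsum, cexp_neg_eq_inv_qParam_pow]
  rw [Finset.prod_insert (by decide), Finset.prod_insert (by decide), Finset.prod_insert (by decide),
    Finset.prod_insert (by decide), Finset.prod_insert (by decide), Finset.prod_insert (by decide),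
    Finset.prod_insert (by decide), Finset.prod_singleton]
  rw [show expFn [(2, -1), (6, 3), (8, 1), (24, -3)] 1 = 0 by decide,
    show expFn [(2, -1), (6, 3), (8, 1), (24, -3)] 2 = -1 by decide,
    show expFn [(2, -1), (6, 3), (8, 1), (24, -3)] 3 = 0 by decide,
    show expFn [(2, -1), (6, 3), (8, 1), (24, -3)] 4 = 0 by decide,
    show expFn [(2, -1), (6, 3), (8, 1), (24, -3)] 6 = 3 by decide,
    show expFn [(2, -1), (6, 3), (8, 1), (24, -3)] 8 = 1 by decide,
    show expFn [(2, -1), (6, 3), (8, 1), (24, -3)] 12 = 0 by decide,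
    show expFn [(2, -1), (6, 3), (8, 1), (24, -3)] 24 = -3 by decide]
  simp only [zpow_neg, zpow_ofNat]
  field_simp

/-- **`y = η(4τ)η(8τ)²η(12τ)⁵/(η(2τ)η(6τ)η(24τ)⁶) = E₄E₈²E₁₂⁵/(q³ E₂ E₆ E₂₄⁶)`.** [folklore] -/
theorem y24_eq (τ : ℍ) :
    etaQuotient 24 (expFn [(2, -1), (4, 1), (6, -1), (8, 2), (12, 5), (24, -6)]) τ
      = eulerFn 4 τ * eulerFn 8 τ ^ 2 * eulerFn 12 τ ^ 5
        / (Function.Periodic.qParam 1 (τ : ℂ) ^ 3 * eulerFn 2 τ * eulerFn 6 τ * eulerFn 24 τ ^ 6) := by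
  have hE2 := eulerFn_ne_zero (by norm_num : 0 < 2) τ
  have hE6 := eulerFn_ne_zero (by norm_num : 0 < 6) τ
  have hE24 := eulerFn_ne_zero (by norm_num : 0 < 24) τ
  have hq := qParam_ne_zero τ
  rw [etaQuotient_eq_cexp_mul_prod, show Nat.divisors 24 = {1, 2, 3, 4, 6, 8, 12, 24} by decide]
  have hsum : (∑ δ ∈ ({1, 2, 3, 4, 6, 8, 12, 24} : Finset ℕ),
      (δ : ℤ) * expFn [(2, -1), (4, 1), (6, -1), (8, 2), (12, 5), (24, -6)] δ) = (-(24 * 3 : ℕ) : ℤ) := by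
    decide
  rw [hsum, cexp_neg_eq_inv_qParam_pow]
  rw [Finset.prod_insert (by decide), Finset.prod_insert (by decide), Finset.prod_insert (by decide),
    Finset.prod_insert (by decide), Finset.prod_insert (by decide), Finset.prod_insert (by decide),
    Finset.prod_insert (by decide), Finset.prod_singleton]
  rw [show expFn [(2, -1), (4, 1), (6, -1), (8, 2), (12, 5), (24, -6)] 1 = 0 by decide,
    show expFn [(2, -1), (4, 1), (6, -1), (8, 2), (12, 5), (24, -6)] 2 = -1 by decide,
    show expFn [(2, -1), (4, 1), (6, -1), (8, 2), (12, 5), (24, -6)] 3 = 0 by decide,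
    show expFn [(2, -1), (4, 1), (6, -1), (8, 2), (12, 5), (24, -6)] 4 = 1 by decide,
    show expFn [(2, -1), (4, 1), (6, -1), (8, 2), (12, 5), (24, -6)] 6 = -1 by decide,
    show expFn [(2, -1), (4, 1), (6, -1), (8, 2), (12, 5), (24, -6)] 8 = 2 by decide,
    show expFn [(2, -1), (4, 1), (6, -1), (8, 2), (12, 5), (24, -6)] 12 = 5 by decide,
    show expFn [(2, -1), (4, 1), (6, -1), (8, 2), (12, 5), (24, -6)] 24 = -6 by decide]
  simp only [zpow_neg, zpow_ofNat]
  field_simp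

/-- **`φ₂₄ = η(2τ)η(4τ)η(6τ)η(12τ) = q E₂E₄E₆E₁₂`.** [folklore] -/
theorem etaProductTwentyFour_eq (τ : ℍ) :
    cuspFormEta24 τ
      = Function.Periodic.qParam 1 (τ : ℂ) * eulerFn 2 τ * eulerFn 4 τ * eulerFn 6 τ * eulerFn 12 τ := by
  have hq := qParam_ne_zero τ
  rw [show (cuspFormEta24 τ : ℂ) = etaQuotient 24 (expFn etaList24) τ from rfl,
    etaQuotient_eq_cexp_mul_prod, show Nat.divisors 24 = {1, 2, 3, 4, 6, 8, 12, 24} by decide]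
  have hsum : (∑ δ ∈ ({1, 2, 3, 4, 6, 8, 12, 24} : Finset ℕ), (δ : ℤ) * expFn etaList24 δ) = ((24 : ℕ) : ℤ) := by
    decide
  rw [hsum]
  have hexp : cexp (2 * π * I * τ / 24 * (((24 : ℕ) : ℤ) : ℂ)) = Function.Periodic.qParam 1 (τ : ℂ) := by
    rw [Function.Periodic.qParam]
    congr 1
    push_cast
    ring
  rw [hexp]
  rw [Finset.prod_insert (by decide), Finset.prod_insert (by decide), Finset.prod_insert (by decide),
    Finset.prod_insert (by decide), Finset.prod_insert (by decide), Finset.prod_insert (by decide),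
    Finset.prod_insert (by decide), Finset.prod_singleton]
  rw [show expFn etaList24 1 = 0 by decide, show expFn etaList24 2 = 1 by decide,
    show expFn etaList24 3 = 0 by decide, show expFn etaList24 4 = 1 by decide,
    show expFn etaList24 6 = 1 by decide, show expFn etaList24 8 = 0 by decide,
    show expFn etaList24 12 = 1 by decide, show expFn etaList24 24 = 0 by decide]
  simp only [zpow_zero, zpow_one, one_mul, mul_one]
  ring

/-! ## 2. The derivatives of `x` and `y` -/

/-- **`x′ = x · (3E₆′/E₆ + E₈′/E₈ − 2·2πi − E₂′/E₂ − 3E₂₄′/E₂₄)`.** [folklore] -/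
theorem deriv_x24 (τ : ℍ) :
    deriv (etaQuotient 24 (expFn [(2, -1), (6, 3), (8, 1), (24, -3)]) ∘ ofComplex) τ
      = eulerFn 6 τ ^ 3 * eulerFn 8 τ
          / (Function.Periodic.qParam 1 (τ : ℂ) ^ 2 * eulerFn 2 τ * eulerFn 24 τ ^ 3)
        * (3 * deriv (eulerFn 6 ∘ ofComplex) τ / eulerFn 6 τ
          + deriv (eulerFn 8 ∘ ofComplex) τ / eulerFn 8 τ - 2 * (2 * π * I)
          - deriv (eulerFn 2 ∘ ofComplex) τ / eulerFn 2 τ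
          - 3 * deriv (eulerFn 24 ∘ ofComplex) τ / eulerFn 24 τ) := by
  have hE2 := eulerFn_ne_zero (by norm_num : 0 < 2) τ
  have hE6 := eulerFn_ne_zero (by norm_num : 0 < 6) τ
  have hE8 := eulerFn_ne_zero (by norm_num : 0 < 8) τ
  have hE24 := eulerFn_ne_zero (by norm_num : 0 < 24) τ
  have hq := qParam_ne_zero τ
  have hfun : (etaQuotient 24 (expFn [(2, -1), (6, 3), (8, 1), (24, -3)]) ∘ ofComplex) =ᶠ[𝓝 (τ : ℂ)]
      fun z ↦ (eulerFn 6 ∘ ofComplex) z ^ 3 * (eulerFn 8 ∘ ofComplex) z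
        / (Function.Periodic.qParam 1 z ^ 2 * (eulerFn 2 ∘ ofComplex) z
          * (eulerFn 24 ∘ ofComplex) z ^ 3) := by
    filter_upwards [isOpen_upperHalfPlaneSet.mem_nhds τ.im_pos] with z hz
    simp only [Function.comp_apply, x24_eq, ofComplex_apply_of_im_pos hz]
  rw [hfun.deriv_eq]
  have h2 := hasDerivAt_eulerFn_comp 2 τ
  have h6 := hasDerivAt_eulerFn_comp 6 τ
  have h8 := hasDerivAt_eulerFn_comp 8 τ
  have h24 := hasDerivAt_eulerFn_comp 24 τ
  have hqd : HasDerivAt (Function.Periodic.qParam 1) (2 * π * I * Function.Periodic.qParam 1 (τ : ℂ)) τ := by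
    simpa using hasDerivAt_qParam 1 (τ : ℂ)
  have hden : Function.Periodic.qParam 1 (τ : ℂ) ^ 2 * (eulerFn 2 ∘ ofComplex) τ
      * (eulerFn 24 ∘ ofComplex) τ ^ 3 ≠ 0 := by
    simp only [Function.comp_apply, ofComplex_apply]
    exact mul_ne_zero (mul_ne_zero (pow_ne_zero _ hq) hE2) (pow_ne_zero _ hE24)
  have hD := ((h6.fun_pow 3).fun_mul h8).fun_div
    (((hqd.fun_pow 2).fun_mul h2).fun_mul (h24.fun_pow 3)) hden
  rw [hD.deriv]
  simp only [Function.comp_apply, ofComplex_apply]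
  field_simp
  ring

/-- **`y′ = y · (E₄′/E₄ + 2E₈′/E₈ + 5E₁₂′/E₁₂ − 3·2πi − E₂′/E₂ − E₆′/E₆ − 6E₂₄′/E₂₄)`.** [folklore] -/
theorem deriv_y24 (τ : ℍ) :
    deriv (etaQuotient 24 (expFn [(2, -1), (4, 1), (6, -1), (8, 2), (12, 5), (24, -6)]) ∘ ofComplex) τ
      = eulerFn 4 τ * eulerFn 8 τ ^ 2 * eulerFn 12 τ ^ 5
          / (Function.Periodic.qParam 1 (τ : ℂ) ^ 3 * eulerFn 2 τ * eulerFn 6 τ * eulerFn 24 τ ^ 6)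
        * (deriv (eulerFn 4 ∘ ofComplex) τ / eulerFn 4 τ
          + 2 * deriv (eulerFn 8 ∘ ofComplex) τ / eulerFn 8 τ
          + 5 * deriv (eulerFn 12 ∘ ofComplex) τ / eulerFn 12 τ - 3 * (2 * π * I)
          - deriv (eulerFn 2 ∘ ofComplex) τ / eulerFn 2 τ
          - deriv (eulerFn 6 ∘ ofComplex) τ / eulerFn 6 τ
          - 6 * deriv (eulerFn 24 ∘ ofComplex) τ / eulerFn 24 τ) := by
  have hE2 := eulerFn_ne_zero (by norm_num : 0 < 2) τ
  have hE4 := eulerFn_ne_zero (by norm_num : 0 < 4) τ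
  have hE6 := eulerFn_ne_zero (by norm_num : 0 < 6) τ
  have hE8 := eulerFn_ne_zero (by norm_num : 0 < 8) τ
  have hE12 := eulerFn_ne_zero (by norm_num : 0 < 12) τ
  have hE24 := eulerFn_ne_zero (by norm_num : 0 < 24) τ
  have hq := qParam_ne_zero τ
  have hfun : (etaQuotient 24 (expFn [(2, -1), (4, 1), (6, -1), (8, 2), (12, 5), (24, -6)]) ∘ ofComplex)
      =ᶠ[𝓝 (τ : ℂ)]
      fun z ↦ (eulerFn 4 ∘ ofComplex) z * (eulerFn 8 ∘ ofComplex) z ^ 2 * (eulerFn 12 ∘ ofComplex) z ^ 5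
        / (Function.Periodic.qParam 1 z ^ 3 * (eulerFn 2 ∘ ofComplex) z * (eulerFn 6 ∘ ofComplex) z
          * (eulerFn 24 ∘ ofComplex) z ^ 6) := by
    filter_upwards [isOpen_upperHalfPlaneSet.mem_nhds τ.im_pos] with z hz
    simp only [Function.comp_apply, y24_eq, ofComplex_apply_of_im_pos hz]
  rw [hfun.deriv_eq]
  have h2 := hasDerivAt_eulerFn_comp 2 τ
  have h4 := hasDerivAt_eulerFn_comp 4 τ
  have h6 := hasDerivAt_eulerFn_comp 6 τ
  have h8 := hasDerivAt_eulerFn_comp 8 τ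
  have h12 := hasDerivAt_eulerFn_comp 12 τ
  have h24 := hasDerivAt_eulerFn_comp 24 τ
  have hqd : HasDerivAt (Function.Periodic.qParam 1) (2 * π * I * Function.Periodic.qParam 1 (τ : ℂ)) τ := by
    simpa using hasDerivAt_qParam 1 (τ : ℂ)
  have hden : Function.Periodic.qParam 1 (τ : ℂ) ^ 3 * (eulerFn 2 ∘ ofComplex) τ * (eulerFn 6 ∘ ofComplex) τ
      * (eulerFn 24 ∘ ofComplex) τ ^ 6 ≠ 0 := by
    simp only [Function.comp_apply, ofComplex_apply]
    exact mul_ne_zero (mul_ne_zero (mul_ne_zero (pow_ne_zero _ hq) hE2) hE6) (pow_ne_zero _ hE24)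
  have hD := (((h4.fun_mul (h8.fun_pow 2)).fun_mul (h12.fun_pow 5))).fun_div
    ((((hqd.fun_pow 3).fun_mul h2).fun_mul h6).fun_mul (h24.fun_pow 6)) hden
  rw [hD.deriv]
  simp only [Function.comp_apply, ofComplex_apply]
  field_simp
  ring

end Summit.BirchSwinnertonDyer.BirchSwinnertonDyer.Theorems.ManinLocalTwoThree.EulerRemaindersTwentyFour

end
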